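import Summits.QuantumFields.BalabanUV.Beta.EriceRemainderEnclosureHistoryAutonomyComparisonAgeCompositionNestedYoungPair

/-!
# EriceRemainderEnclosureHistoryAutonomyComparisonAgeCompositionJointPolytope — (E93a) route (N), first order: THE JOINT TWO-PAIR POLYTOPE (pure).  The
# nested bound of (E92d)∕(E92f) with ALL THREE actual loads kept, `Φ = (1−x₁)((1−x₂)(1−x₃) − E x₂x₃) − Bx₁x₂ − Cx₁x₃` (`E = 2(k₂+1)∕k₃`, `B = 4∕k₂`,
# `C = 4∕k₃`), is non-increasing in each load, so on the polytope `{xᵢ ≤ s, x₁+x₂ ≤ σ₁, x₂+x₃ ≤ σ₂}` cut out by BOTH pair share bounds of (E92b) it is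
# bounded below by a function of the middle load alone; a FLATTENED PIECEWISE CERTIFICATE (four regimes of `x₂`; the middle residual above a constant per
# regime; an affine or convex remainder tested on its tangent) makes `Φ ≥ 0` a finite list of displayed inequalities.  Numerically (README g83∕e92 §5(1),
# `g83/numerics/joint_cert3.py`) this certificate holds for the census three ages `{1,k₂,k₃}` for EVERY `k₃ ≥ 57` when `18 ≤ k₂ ≤ 45` (and from
# `k₃ = 59 ∕ 65 ∕ 71` for `k₂ = 16 ∕ 15 ∕ 14`) — the bounded gap left by (E92g); the flow wiring is (E93b) `…NestedTwoPairs`, the rational bands are successor work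

Cell `pub-balaban`, β-function sub-cell, BINDER row D4 «RemainderConst leaves for Bałaban's split» (`HOME/BINDER-OWNERS.md`; owner lineage `b2b-balaban-beta-an4`;
this file by co-owner #2 lineage `b2b-balaban-beta-d4-p2`, generation 83), β-FLOW TEAM duty (1), FREEZE (0) honoured (def-free; nothing restated; pure real
algebra, Mathlib only in effect).

HONEST FRAMING (page 1, verbatim and binding).  *"Discharging BetaPertH makes Bałaban's UV stability UNCONDITIONAL — a real constructive-QFT result; it is
NOT the continuum limit and NOT the Clay problem."*  THIS FILE DISCHARGES NOTHING OF THE KIND.  Elementary real algebra; nothing about Bałaban's objects;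
row D4 class UNCHANGED (critical-path width 0; instance 0∕1; D4 DISCHARGE NO DATE); NOT B12 Thm 2, NOT BetaPertH, NOT continuum, NOT Clay.

WHAT IS PROVED ([folklore]; 0 `def`, 0 sorry).  `convex_quad_ge_tangent`, `affine_nonneg_between`, `concave_ge_const`, **`joint_polytope_nonneg`**;
v2 (same generation, APPEND-ONLY): **`joint_polytope_nonneg_guarded`** (empty regimes carry no hypotheses — the band-ready form).
-/
noncomputable section

namespace Summit.QuantumFields.BalabanUV.Beta.EriceRemainderEnclosureHistoryAutonomyComparisonAgeCompositionJointPolytope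

/-- A convex quadratic lies above its tangents: `q(u) = αu² + βu + γ`, `α ≥ 0` ⟹ `q(u) ≥ q(a) + q′(a)(u − a)`. [folklore] -/
theorem convex_quad_ge_tangent {α β γ a u : ℝ} (hα : 0 ≤ α) :
    (α * a ^ 2 + β * a + γ) + (2 * α * a + β) * (u - a) ≤ α * u ^ 2 + β * u + γ := by
  nlinarith [mul_nonneg hα (sq_nonneg (u - a))]

/-- An affine function `f0 + slope·(t − t₀)` non-negative at `t₀` and at `t₁` is non-negative on `[t₀, t₁]`. [folklore] -/
theorem affine_nonneg_between {f0 slope t₀ t₁ t : ℝ} (h0 : 0 ≤ f0) (h1 : 0 ≤ f0 + slope * (t₁ - t₀)) (ht0 : t₀ ≤ t) (ht1 : t ≤ t₁) :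
    0 ≤ f0 + slope * (t - t₀) := by
  rcases le_or_gt 0 slope with hc | hc
  · nlinarith [mul_nonneg hc (sub_nonneg.2 ht0)]
  · nlinarith [mul_nonneg (neg_nonneg.2 hc.le) (sub_nonneg.2 ht1)]

/-- A concave quadratic stays above a constant between two points where it does: `R(u) = r₀ + c·u·(σ − u)`, `c ≥ 0`, `ρ ≤ R(a)`, `ρ ≤ R(b)`,
`a ≤ u ≤ b` ⟹ `ρ ≤ R(u)` (`(b−a)(R(u)−ρ) = (b−u)(R(a)−ρ) + (u−a)(R(b)−ρ) + c(b−a)(u−a)(b−u)`). [folklore] -/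
theorem concave_ge_const {r0 c σ ρ a b u : ℝ} (hc : 0 ≤ c) (ha : ρ ≤ r0 + c * a * (σ - a)) (hb : ρ ≤ r0 + c * b * (σ - b))
    (hau : a ≤ u) (hub : u ≤ b) : ρ ≤ r0 + c * u * (σ - u) := by
  rcases (hau.trans hub).eq_or_lt with heq | hlt
  · have : u = a := le_antisymm (by rw [heq]; exact hub) hau
    rw [this]; exact ha
  -- (b − a)(R(u) − ρ) ≥ (b − u)(R(a) − ρ) + (u − a)(R(b) − ρ) + c (b−a)(u−a)(b−u) ≥ 0
  have key : (b - a) * (r0 + c * u * (σ - u) - ρ)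
      = (b - u) * (r0 + c * a * (σ - a) - ρ) + (u - a) * (r0 + c * b * (σ - b) - ρ) + c * (b - a) * (u - a) * (b - u) := by ring
  have hR : 0 ≤ (b - u) * (r0 + c * a * (σ - a) - ρ) + (u - a) * (r0 + c * b * (σ - b) - ρ) + c * (b - a) * (u - a) * (b - u) := by
    have := mul_nonneg (sub_nonneg.2 hub) (sub_nonneg.2 ha)
    have := mul_nonneg (sub_nonneg.2 hau) (sub_nonneg.2 hb)
    have := mul_nonneg (mul_nonneg (mul_nonneg hc (sub_nonneg.2 hlt.le)) (sub_nonneg.2 hau)) (sub_nonneg.2 hub)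
    linarith
  by_contra hneg
  have : (b - a) * (r0 + c * u * (σ - u) - ρ) < 0 := mul_neg_of_pos_of_neg (sub_pos.2 hlt) (by linarith)
  linarith

/-- **THE JOINT TWO-PAIR POLYTOPE (pure).**  `Φ = (1−x₁)((1−x₂)(1−x₃) − E·x₂x₃) − B·x₁x₂ − C·x₁x₃` on `{0 ≤ xᵢ ≤ s, x₁ + x₂ ≤ σ₁, x₂ + x₃ ≤ σ₂}`
with `0 ≤ E ≤ 1`, `0 ≤ C ≤ B`, `0 ≤ s ≤ 1`.  `Φ` is non-increasing in `x₃`, and in `x₁` wherever the middle residual `R₂ = (1−x₂)(1−x₃) − E x₂x₃` is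
`≥ 0`; pushing `x₃` to `x₃* = min(s, σ₂−x₂)` and `x₁` to `x₁* = min(s, σ₁−x₂)` leaves a function of `x₂` alone, in four regimes (`x₂ ≶ σ₁−s`,
`x₂ ≶ σ₂−s`).  THE FLATTENED CERTIFICATE: on each regime `R₂(x₂, x₃*) ≥ ρ ≥ 0` for a displayed constant `ρ` (an affine decreasing bound, or
`concave_ge_const` on `[σ₂−s, σ₁−s]` ∕ `[a₂, s]`), and the remainder `(1−x₁*)ρ − x₁*(Bx₂ + Cx₃*)` — affine, or a convex quadratic bounded by its tangent
at the regime's left end — is `≥ 0` at the displayed points.  The certificate points `b₁ ≥ min(σ₁,σ₂) − s`, `a₂ ≤ max(σ₁,σ₂) − s` enter through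
disjunctions.  Conclusion: `Φ ≥ 0` and `R₂(x₂,x₃) ≥ 0`. [folklore] -/
theorem joint_polytope_nonneg {s σ₁ σ₂ E B C x₁ x₂ x₃ b₁ a₂ ρ₁ ρ₂ ρ₃ ρ₄ : ℝ}
    (hs0 : 0 ≤ s) (hs1 : s ≤ 1)
    (hx1 : 0 ≤ x₁) (hx1s : x₁ ≤ s) (hx2 : 0 ≤ x₂) (hx2s : x₂ ≤ s) (hx3 : 0 ≤ x₃) (hx3s : x₃ ≤ s)
    (h12 : x₁ + x₂ ≤ σ₁) (h23 : x₂ + x₃ ≤ σ₂)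
    (hE0 : 0 ≤ E) (hE1 : E ≤ 1) (hC0 : 0 ≤ C) (hCB : C ≤ B)
    -- piece A1 (x₂ ≤ σ₁ − s, x₂ ≤ σ₂ − s): certificate point b₁ ≥ min(σ₁, σ₂) − s
    (hb1 : σ₁ - s ≤ b₁ ∨ σ₂ - s ≤ b₁)
    (hρ1 : ρ₁ ≤ (1 - s) - b₁ * ((1 - s) + E * s)) (c1ρ : 0 ≤ ρ₁)
    (c1 : 0 ≤ (1 - s) * ρ₁ - s * (B * b₁ + C * s))
    -- piece A2 (σ₁ − s < x₂ ≤ σ₂ − s)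
    (hρ2 : ρ₂ ≤ (1 - s) - (σ₂ - s) * ((1 - s) + E * s)) (c2ρ : 0 ≤ ρ₂)
    (c2a : 0 ≤ (1 - σ₁ + (σ₁ - s)) * ρ₂ - (σ₁ - (σ₁ - s)) * (B * (σ₁ - s) + C * s))
    (c2b : 0 ≤ (1 - σ₁ + (σ₁ - s)) * ρ₂ - (σ₁ - (σ₁ - s)) * (B * (σ₁ - s) + C * s)
        + (ρ₂ + (B * (σ₁ - s) + C * s) - (σ₁ - (σ₁ - s)) * B) * ((σ₂ - s) - (σ₁ - s)))
    -- piece B1 (σ₂ − s < x₂ ≤ σ₁ − s)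
    (hρ3a : ρ₃ ≤ (1 - σ₂) + (1 - E) * (σ₂ - s) * (σ₂ - (σ₂ - s))) (hρ3b : ρ₃ ≤ (1 - σ₂) + (1 - E) * (σ₁ - s) * (σ₂ - (σ₁ - s)))
    (c3ρ : 0 ≤ ρ₃)
    (c3 : 0 ≤ (1 - s) * ρ₃ - s * (B * (σ₁ - s) + C * (σ₂ - (σ₁ - s))))
    -- piece B2 (x₂ > σ₁ − s, x₂ > σ₂ − s): certificate point a₂ ≤ max(σ₁, σ₂) − s
    (ha2 : a₂ ≤ σ₁ - s ∨ a₂ ≤ σ₂ - s)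
    (hρ4a : ρ₄ ≤ (1 - σ₂) + (1 - E) * a₂ * (σ₂ - a₂)) (hρ4b : ρ₄ ≤ (1 - σ₂) + (1 - E) * s * (σ₂ - s)) (c4ρ : 0 ≤ ρ₄)
    (c4a : 0 ≤ (1 - σ₁ + a₂) * ρ₄ - (σ₁ - a₂) * (B * a₂ + C * (σ₂ - a₂)))
    (c4b : 0 ≤ (1 - σ₁ + a₂) * ρ₄ - (σ₁ - a₂) * (B * a₂ + C * (σ₂ - a₂))
        + (ρ₄ + (B * a₂ + C * (σ₂ - a₂)) - (σ₁ - a₂) * (B - C)) * (s - a₂)) :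
    0 ≤ (1 - x₁) * ((1 - x₂) * (1 - x₃) - E * x₂ * x₃) - B * x₁ * x₂ - C * x₁ * x₃
    ∧ 0 ≤ (1 - x₂) * (1 - x₃) - E * x₂ * x₃ := by
  have hB0 : 0 ≤ B := hC0.trans hCB
  have h1x1 : 0 ≤ 1 - x₁ := by linarith
  have h1x2 : 0 ≤ 1 - x₂ := by linarith
  -- the x₃-slopes are ≤ 0: pushing x₃ up to X₃ ≥ x₃ lowers R₂ and Φ
  have push3 : ∀ X₃, x₃ ≤ X₃ →
      (1 - x₂) * (1 - X₃) - E * x₂ * X₃ ≤ (1 - x₂) * (1 - x₃) - E * x₂ * x₃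
      ∧ (1 - x₁) * ((1 - x₂) * (1 - X₃) - E * x₂ * X₃) - B * x₁ * x₂ - C * x₁ * X₃
        ≤ (1 - x₁) * ((1 - x₂) * (1 - x₃) - E * x₂ * x₃) - B * x₁ * x₂ - C * x₁ * x₃ := by
    intro X₃ hX
    have hd : 0 ≤ X₃ - x₃ := sub_nonneg.2 hX
    have h1 := mul_nonneg (add_nonneg h1x2 (mul_nonneg hE0 hx2)) hd
    have h2 := mul_nonneg (add_nonneg (mul_nonneg h1x1 (add_nonneg h1x2 (mul_nonneg hE0 hx2))) (mul_nonneg hC0 hx1)) hd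
    have e1 : (1 - x₂) * (1 - x₃) - E * x₂ * x₃ - ((1 - x₂) * (1 - X₃) - E * x₂ * X₃) = ((1 - x₂) + E * x₂) * (X₃ - x₃) := by ring
    have e2 : (1 - x₁) * ((1 - x₂) * (1 - x₃) - E * x₂ * x₃) - B * x₁ * x₂ - C * x₁ * x₃
        - ((1 - x₁) * ((1 - x₂) * (1 - X₃) - E * x₂ * X₃) - B * x₁ * x₂ - C * x₁ * X₃)
        = ((1 - x₁) * ((1 - x₂) + E * x₂) + C * x₁) * (X₃ - x₃) := by ring
    constructor
    · linarith only [h1, e1]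
    · linarith only [h2, e2]
  -- pushing x₁ up to X₁ ≥ x₁ lowers Φ when R₂ ≥ 0 (at the pushed x₃)
  have push1 : ∀ X₁ X₃, x₁ ≤ X₁ → 0 ≤ X₃ → 0 ≤ (1 - x₂) * (1 - X₃) - E * x₂ * X₃ →
      (1 - X₁) * ((1 - x₂) * (1 - X₃) - E * x₂ * X₃) - B * X₁ * x₂ - C * X₁ * X₃
        ≤ (1 - x₁) * ((1 - x₂) * (1 - X₃) - E * x₂ * X₃) - B * x₁ * x₂ - C * x₁ * X₃ := by
    intro X₁ X₃ hX hX3 hR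
    have hd : 0 ≤ X₁ - x₁ := sub_nonneg.2 hX
    have h1 := mul_nonneg (add_nonneg (add_nonneg hR (mul_nonneg hB0 hx2)) (mul_nonneg hC0 hX3)) hd
    have e1 : (1 - x₁) * ((1 - x₂) * (1 - X₃) - E * x₂ * X₃) - B * x₁ * x₂ - C * x₁ * X₃
        - ((1 - X₁) * ((1 - x₂) * (1 - X₃) - E * x₂ * X₃) - B * X₁ * x₂ - C * X₁ * X₃)
        = (((1 - x₂) * (1 - X₃) - E * x₂ * X₃) + B * x₂ + C * X₃) * (X₁ - x₁) := by ring
    linarith only [h1, e1]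
  rcases le_or_gt x₂ (σ₂ - s) with hA | hB
  · -- x₃* = s
    obtain ⟨hR3, hΦ3⟩ := push3 s hx3s
    rcases le_or_gt x₂ (σ₁ - s) with hA1 | hA2
    · -- A1: x₁* = s; everything decreasing in x₂ ≤ b₁
      have hxb : x₂ ≤ b₁ := by rcases hb1 with h | h <;> linarith
      have hRs : ρ₁ ≤ (1 - x₂) * (1 - s) - E * x₂ * s := by
        have : 0 ≤ (b₁ - x₂) * ((1 - s) + E * s) := mul_nonneg (by linarith) (add_nonneg (by linarith) (mul_nonneg hE0 hs0))
        linarith only [this, hρ1]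
      have hR0 : 0 ≤ (1 - x₂) * (1 - s) - E * x₂ * s := c1ρ.trans hRs
      have hΦ1 := push1 s s hx1s hs0 hR0
      refine ⟨?_, hR0.trans hR3⟩
      -- Φ(s, x₂, s) = (1−s)R₂(x₂,s) − s(Bx₂ + Cs) ≥ (1−s)ρ₁ − s(B b₁ + C s) ≥ 0
      have h1 : (1 - s) * ρ₁ ≤ (1 - s) * ((1 - x₂) * (1 - s) - E * x₂ * s) := mul_le_mul_of_nonneg_left hRs (by linarith)
      have h2 : s * (B * x₂ + C * s) ≤ s * (B * b₁ + C * s) :=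
        mul_le_mul_of_nonneg_left (by linarith [mul_le_mul_of_nonneg_left hxb hB0]) hs0
      linarith only [hΦ3, hΦ1, h1, h2, c1]
    · -- A2: x₁* = σ₁ − x₂ ∈ [0, s)
      have hX1 : x₁ ≤ σ₁ - x₂ := by linarith
      have hRs : ρ₂ ≤ (1 - x₂) * (1 - s) - E * x₂ * s := by
        have : 0 ≤ ((σ₂ - s) - x₂) * ((1 - s) + E * s) := mul_nonneg (by linarith) (add_nonneg (by linarith) (mul_nonneg hE0 hs0))
        linarith only [this, hρ2]
      have hR0 : 0 ≤ (1 - x₂) * (1 - s) - E * x₂ * s := c2ρ.trans hRs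
      have hΦ1 := push1 (σ₁ - x₂) s hX1 hs0 hR0
      refine ⟨?_, hR0.trans hR3⟩
      -- Φ(σ₁−x₂, x₂, s) ≥ (1−σ₁+x₂)ρ₂ − (σ₁−x₂)(Bx₂ + Cs) =: q(x₂), convex in x₂ (coefficient B): tangent at σ₁ − s
      have h1σ : 0 ≤ 1 - (σ₁ - x₂) := by linarith
      have h1 : (1 - (σ₁ - x₂)) * ρ₂ ≤ (1 - (σ₁ - x₂)) * ((1 - x₂) * (1 - s) - E * x₂ * s) := mul_le_mul_of_nonneg_left hRs h1σ
      have htan := convex_quad_ge_tangent (α := B) (β := ρ₂ + C * s - σ₁ * B) (γ := (1 - σ₁) * ρ₂ - σ₁ * C * s) (a := σ₁ - s) (u := x₂) hB0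
      have hline := affine_nonneg_between (t₀ := σ₁ - s) (t₁ := σ₂ - s) (t := x₂) c2a c2b hA2.le hA
      linarith only [h1, htan, hline, hΦ1, hΦ3]
  · -- x₃* = σ₂ − x₂ ∈ [0, s)
    have hX3 : x₃ ≤ σ₂ - x₂ := by linarith
    have hX30 : 0 ≤ σ₂ - x₂ := hx3.trans hX3
    obtain ⟨hR3, hΦ3⟩ := push3 (σ₂ - x₂) hX3
    -- R₂(x₂, σ₂ − x₂) = (1 − σ₂) + (1−E) x₂ (σ₂ − x₂)
    have eR : (1 - x₂) * (1 - (σ₂ - x₂)) - E * x₂ * (σ₂ - x₂) = (1 - σ₂) + (1 - E) * x₂ * (σ₂ - x₂) := by ring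
    rcases le_or_gt x₂ (σ₁ - s) with hB1 | hB2
    · -- B1: x₁* = s; R₂* ≥ ρ₃ by concavity on [σ₂ − s, σ₁ − s]
      have hRs : ρ₃ ≤ (1 - σ₂) + (1 - E) * x₂ * (σ₂ - x₂) :=
        concave_ge_const (by linarith) hρ3a hρ3b hB.le hB1
      have hR0 : 0 ≤ (1 - x₂) * (1 - (σ₂ - x₂)) - E * x₂ * (σ₂ - x₂) := by rw [eR]; exact c3ρ.trans hRs
      have hΦ1 := push1 s (σ₂ - x₂) hx1s hX30 hR0
      refine ⟨?_, hR0.trans hR3⟩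
      have h1 : (1 - s) * ρ₃ ≤ (1 - s) * ((1 - σ₂) + (1 - E) * x₂ * (σ₂ - x₂)) := mul_le_mul_of_nonneg_left hRs (by linarith)
      -- remainder affine decreasing in x₂ (slope −s(B − C) ≤ 0): evaluate at σ₁ − s
      have h2 : s * (B * x₂ + C * (σ₂ - x₂)) ≤ s * (B * (σ₁ - s) + C * (σ₂ - (σ₁ - s))) := by
        have : 0 ≤ s * (B - C) * ((σ₁ - s) - x₂) := mul_nonneg (mul_nonneg hs0 (by linarith)) (by linarith)
        linarith only [this]
      linarith only [hΦ1, hΦ3, h1, h2, eR, c3]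
    · -- B2: x₁* = σ₁ − x₂; R₂* ≥ ρ₄ by concavity on [a₂, s]
      have hX1 : x₁ ≤ σ₁ - x₂ := by linarith
      have ha2x : a₂ ≤ x₂ := by rcases ha2 with h | h <;> linarith
      have hRs : ρ₄ ≤ (1 - σ₂) + (1 - E) * x₂ * (σ₂ - x₂) := concave_ge_const (by linarith) hρ4a hρ4b ha2x hx2s
      have hR0 : 0 ≤ (1 - x₂) * (1 - (σ₂ - x₂)) - E * x₂ * (σ₂ - x₂) := by rw [eR]; exact c4ρ.trans hRs
      have hΦ1 := push1 (σ₁ - x₂) (σ₂ - x₂) hX1 hX30 hR0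
      refine ⟨?_, hR0.trans hR3⟩
      have h1σ : 0 ≤ 1 - (σ₁ - x₂) := by linarith
      have h1 : (1 - (σ₁ - x₂)) * ρ₄ ≤ (1 - (σ₁ - x₂)) * ((1 - σ₂) + (1 - E) * x₂ * (σ₂ - x₂)) := mul_le_mul_of_nonneg_left hRs h1σ
      -- q(u) = (1−σ₁+u)ρ₄ − (σ₁−u)(Bu + C(σ₂−u)) = (B − C)u² + (ρ₄ + Cσ₂ − σ₁(B − C)·1 … ) : convex, tangent at a₂
      have htan := convex_quad_ge_tangent (α := B - C) (β := ρ₄ + C * σ₂ - σ₁ * (B - C)) (γ := (1 - σ₁) * ρ₄ - σ₁ * C * σ₂) (a := a₂) (u := x₂)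
        (by linarith)
      have hline := affine_nonneg_between (t₀ := a₂) (t₁ := s) (t := x₂) c4a c4b ha2x hx2s
      linarith only [h1, htan, hline, hΦ1, hΦ3, eR]

/-- **THE JOINT TWO-PAIR POLYTOPE, GUARDED (pure; v2, APPEND-ONLY).**  As `joint_polytope_nonneg`, but the certificate data of the regimes
`σ₁ − s < x₂ ≤ σ₂ − s` and `σ₂ − s < x₂ ≤ σ₁ − s` are required only when the regime is non-empty (`σ₁ < σ₂`, resp. `σ₂ < σ₁`): the form that ONE set of
rational data can satisfy for a whole band of `(k₂, k₃)` (README g83∕e92 §5(1)). [folklore] -/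
theorem joint_polytope_nonneg_guarded {s σ₁ σ₂ E B C x₁ x₂ x₃ b₁ a₂ ρ₁ ρ₂ ρ₃ ρ₄ : ℝ}
    (hs0 : 0 ≤ s) (hs1 : s ≤ 1)
    (hx1 : 0 ≤ x₁) (hx1s : x₁ ≤ s) (hx2 : 0 ≤ x₂) (hx2s : x₂ ≤ s) (hx3 : 0 ≤ x₃) (hx3s : x₃ ≤ s)
    (h12 : x₁ + x₂ ≤ σ₁) (h23 : x₂ + x₃ ≤ σ₂)
    (hE0 : 0 ≤ E) (hE1 : E ≤ 1) (hC0 : 0 ≤ C) (hCB : C ≤ B)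
    -- piece A1 (x₂ ≤ σ₁ − s, x₂ ≤ σ₂ − s): certificate point b₁ ≥ min(σ₁, σ₂) − s
    (hb1 : σ₁ - s ≤ b₁ ∨ σ₂ - s ≤ b₁)
    (hρ1 : ρ₁ ≤ (1 - s) - b₁ * ((1 - s) + E * s)) (c1ρ : 0 ≤ ρ₁)
    (c1 : 0 ≤ (1 - s) * ρ₁ - s * (B * b₁ + C * s))
    -- piece A2 (σ₁ − s < x₂ ≤ σ₂ − s)
    (hρ2 : σ₁ < σ₂ → ρ₂ ≤ (1 - s) - (σ₂ - s) * ((1 - s) + E * s)) (c2ρ : σ₁ < σ₂ → 0 ≤ ρ₂)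
    (c2a : σ₁ < σ₂ → 0 ≤ (1 - σ₁ + (σ₁ - s)) * ρ₂ - (σ₁ - (σ₁ - s)) * (B * (σ₁ - s) + C * s))
    (c2b : σ₁ < σ₂ → 0 ≤ (1 - σ₁ + (σ₁ - s)) * ρ₂ - (σ₁ - (σ₁ - s)) * (B * (σ₁ - s) + C * s)
        + (ρ₂ + (B * (σ₁ - s) + C * s) - (σ₁ - (σ₁ - s)) * B) * ((σ₂ - s) - (σ₁ - s)))
    -- piece B1 (σ₂ − s < x₂ ≤ σ₁ − s)
    (hρ3a : σ₂ < σ₁ → ρ₃ ≤ (1 - σ₂) + (1 - E) * (σ₂ - s) * (σ₂ - (σ₂ - s)))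
    (hρ3b : σ₂ < σ₁ → ρ₃ ≤ (1 - σ₂) + (1 - E) * (σ₁ - s) * (σ₂ - (σ₁ - s))) (c3ρ : σ₂ < σ₁ → 0 ≤ ρ₃)
    (c3 : σ₂ < σ₁ → 0 ≤ (1 - s) * ρ₃ - s * (B * (σ₁ - s) + C * (σ₂ - (σ₁ - s))))
    -- piece B2 (x₂ > σ₁ − s, x₂ > σ₂ − s): certificate point a₂ ≤ max(σ₁, σ₂) − s
    (ha2 : a₂ ≤ σ₁ - s ∨ a₂ ≤ σ₂ - s)
    (hρ4a : ρ₄ ≤ (1 - σ₂) + (1 - E) * a₂ * (σ₂ - a₂)) (hρ4b : ρ₄ ≤ (1 - σ₂) + (1 - E) * s * (σ₂ - s)) (c4ρ : 0 ≤ ρ₄)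
    (c4a : 0 ≤ (1 - σ₁ + a₂) * ρ₄ - (σ₁ - a₂) * (B * a₂ + C * (σ₂ - a₂)))
    (c4b : 0 ≤ (1 - σ₁ + a₂) * ρ₄ - (σ₁ - a₂) * (B * a₂ + C * (σ₂ - a₂))
        + (ρ₄ + (B * a₂ + C * (σ₂ - a₂)) - (σ₁ - a₂) * (B - C)) * (s - a₂)) :
    0 ≤ (1 - x₁) * ((1 - x₂) * (1 - x₃) - E * x₂ * x₃) - B * x₁ * x₂ - C * x₁ * x₃
    ∧ 0 ≤ (1 - x₂) * (1 - x₃) - E * x₂ * x₃ := by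
  have hB0 : 0 ≤ B := hC0.trans hCB
  have h1x1 : 0 ≤ 1 - x₁ := by linarith
  have h1x2 : 0 ≤ 1 - x₂ := by linarith
  -- the x₃-slopes are ≤ 0: pushing x₃ up to X₃ ≥ x₃ lowers R₂ and Φ
  have push3 : ∀ X₃, x₃ ≤ X₃ →
      (1 - x₂) * (1 - X₃) - E * x₂ * X₃ ≤ (1 - x₂) * (1 - x₃) - E * x₂ * x₃
      ∧ (1 - x₁) * ((1 - x₂) * (1 - X₃) - E * x₂ * X₃) - B * x₁ * x₂ - C * x₁ * X₃
        ≤ (1 - x₁) * ((1 - x₂) * (1 - x₃) - E * x₂ * x₃) - B * x₁ * x₂ - C * x₁ * x₃ := by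
    intro X₃ hX
    have hd : 0 ≤ X₃ - x₃ := sub_nonneg.2 hX
    have h1 := mul_nonneg (add_nonneg h1x2 (mul_nonneg hE0 hx2)) hd
    have h2 := mul_nonneg (add_nonneg (mul_nonneg h1x1 (add_nonneg h1x2 (mul_nonneg hE0 hx2))) (mul_nonneg hC0 hx1)) hd
    have e1 : (1 - x₂) * (1 - x₃) - E * x₂ * x₃ - ((1 - x₂) * (1 - X₃) - E * x₂ * X₃) = ((1 - x₂) + E * x₂) * (X₃ - x₃) := by ring
    have e2 : (1 - x₁) * ((1 - x₂) * (1 - x₃) - E * x₂ * x₃) - B * x₁ * x₂ - C * x₁ * x₃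
        - ((1 - x₁) * ((1 - x₂) * (1 - X₃) - E * x₂ * X₃) - B * x₁ * x₂ - C * x₁ * X₃)
        = ((1 - x₁) * ((1 - x₂) + E * x₂) + C * x₁) * (X₃ - x₃) := by ring
    constructor
    · linarith only [h1, e1]
    · linarith only [h2, e2]
  -- pushing x₁ up to X₁ ≥ x₁ lowers Φ when R₂ ≥ 0 (at the pushed x₃)
  have push1 : ∀ X₁ X₃, x₁ ≤ X₁ → 0 ≤ X₃ → 0 ≤ (1 - x₂) * (1 - X₃) - E * x₂ * X₃ →
      (1 - X₁) * ((1 - x₂) * (1 - X₃) - E * x₂ * X₃) - B * X₁ * x₂ - C * X₁ * X₃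
        ≤ (1 - x₁) * ((1 - x₂) * (1 - X₃) - E * x₂ * X₃) - B * x₁ * x₂ - C * x₁ * X₃ := by
    intro X₁ X₃ hX hX3 hR
    have hd : 0 ≤ X₁ - x₁ := sub_nonneg.2 hX
    have h1 := mul_nonneg (add_nonneg (add_nonneg hR (mul_nonneg hB0 hx2)) (mul_nonneg hC0 hX3)) hd
    have e1 : (1 - x₁) * ((1 - x₂) * (1 - X₃) - E * x₂ * X₃) - B * x₁ * x₂ - C * x₁ * X₃
        - ((1 - X₁) * ((1 - x₂) * (1 - X₃) - E * x₂ * X₃) - B * X₁ * x₂ - C * X₁ * X₃)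
        = (((1 - x₂) * (1 - X₃) - E * x₂ * X₃) + B * x₂ + C * X₃) * (X₁ - x₁) := by ring
    linarith only [h1, e1]
  rcases le_or_gt x₂ (σ₂ - s) with hA | hB
  · -- x₃* = s
    obtain ⟨hR3, hΦ3⟩ := push3 s hx3s
    rcases le_or_gt x₂ (σ₁ - s) with hA1 | hA2
    · -- A1: x₁* = s; everything decreasing in x₂ ≤ b₁
      have hxb : x₂ ≤ b₁ := by rcases hb1 with h | h <;> linarith
      have hRs : ρ₁ ≤ (1 - x₂) * (1 - s) - E * x₂ * s := by
        have : 0 ≤ (b₁ - x₂) * ((1 - s) + E * s) := mul_nonneg (by linarith) (add_nonneg (by linarith) (mul_nonneg hE0 hs0))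
        linarith only [this, hρ1]
      have hR0 : 0 ≤ (1 - x₂) * (1 - s) - E * x₂ * s := c1ρ.trans hRs
      have hΦ1 := push1 s s hx1s hs0 hR0
      refine ⟨?_, hR0.trans hR3⟩
      -- Φ(s, x₂, s) = (1−s)R₂(x₂,s) − s(Bx₂ + Cs) ≥ (1−s)ρ₁ − s(B b₁ + C s) ≥ 0
      have h1 : (1 - s) * ρ₁ ≤ (1 - s) * ((1 - x₂) * (1 - s) - E * x₂ * s) := mul_le_mul_of_nonneg_left hRs (by linarith)
      have h2 : s * (B * x₂ + C * s) ≤ s * (B * b₁ + C * s) :=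
        mul_le_mul_of_nonneg_left (by linarith [mul_le_mul_of_nonneg_left hxb hB0]) hs0
      linarith only [hΦ3, hΦ1, h1, h2, c1]
    · -- A2: x₁* = σ₁ − x₂ ∈ [0, s); the regime is non-empty, so σ₁ < σ₂
      have hlt : σ₁ < σ₂ := by linarith
      have hX1 : x₁ ≤ σ₁ - x₂ := by linarith
      have hRs : ρ₂ ≤ (1 - x₂) * (1 - s) - E * x₂ * s := by
        have : 0 ≤ ((σ₂ - s) - x₂) * ((1 - s) + E * s) := mul_nonneg (by linarith) (add_nonneg (by linarith) (mul_nonneg hE0 hs0))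
        linarith only [this, hρ2 hlt]
      have hR0 : 0 ≤ (1 - x₂) * (1 - s) - E * x₂ * s := (c2ρ hlt).trans hRs
      have hΦ1 := push1 (σ₁ - x₂) s hX1 hs0 hR0
      refine ⟨?_, hR0.trans hR3⟩
      -- Φ(σ₁−x₂, x₂, s) ≥ (1−σ₁+x₂)ρ₂ − (σ₁−x₂)(Bx₂ + Cs) =: q(x₂), convex in x₂ (coefficient B): tangent at σ₁ − s
      have h1σ : 0 ≤ 1 - (σ₁ - x₂) := by linarith
      have h1 : (1 - (σ₁ - x₂)) * ρ₂ ≤ (1 - (σ₁ - x₂)) * ((1 - x₂) * (1 - s) - E * x₂ * s) := mul_le_mul_of_nonneg_left hRs h1σ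
      have htan := convex_quad_ge_tangent (α := B) (β := ρ₂ + C * s - σ₁ * B) (γ := (1 - σ₁) * ρ₂ - σ₁ * C * s) (a := σ₁ - s) (u := x₂) hB0
      have hline := affine_nonneg_between (t₀ := σ₁ - s) (t₁ := σ₂ - s) (t := x₂) (c2a hlt) (c2b hlt) hA2.le hA
      linarith only [h1, htan, hline, hΦ1, hΦ3]
  · -- x₃* = σ₂ − x₂ ∈ [0, s)
    have hX3 : x₃ ≤ σ₂ - x₂ := by linarith
    have hX30 : 0 ≤ σ₂ - x₂ := hx3.trans hX3
    obtain ⟨hR3, hΦ3⟩ := push3 (σ₂ - x₂) hX3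
    -- R₂(x₂, σ₂ − x₂) = (1 − σ₂) + (1−E) x₂ (σ₂ − x₂)
    have eR : (1 - x₂) * (1 - (σ₂ - x₂)) - E * x₂ * (σ₂ - x₂) = (1 - σ₂) + (1 - E) * x₂ * (σ₂ - x₂) := by ring
    rcases le_or_gt x₂ (σ₁ - s) with hB1 | hB2
    · -- B1: x₁* = s; the regime is non-empty, so σ₂ < σ₁; R₂* ≥ ρ₃ by concavity on [σ₂ − s, σ₁ − s]
      have hlt : σ₂ < σ₁ := by linarith
      have hRs : ρ₃ ≤ (1 - σ₂) + (1 - E) * x₂ * (σ₂ - x₂) :=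
        concave_ge_const (by linarith) (hρ3a hlt) (hρ3b hlt) hB.le hB1
      have hR0 : 0 ≤ (1 - x₂) * (1 - (σ₂ - x₂)) - E * x₂ * (σ₂ - x₂) := by rw [eR]; exact (c3ρ hlt).trans hRs
      have hΦ1 := push1 s (σ₂ - x₂) hx1s hX30 hR0
      refine ⟨?_, hR0.trans hR3⟩
      have h1 : (1 - s) * ρ₃ ≤ (1 - s) * ((1 - σ₂) + (1 - E) * x₂ * (σ₂ - x₂)) := mul_le_mul_of_nonneg_left hRs (by linarith)
      -- remainder affine decreasing in x₂ (slope −s(B − C) ≤ 0): evaluate at σ₁ − s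
      have h2 : s * (B * x₂ + C * (σ₂ - x₂)) ≤ s * (B * (σ₁ - s) + C * (σ₂ - (σ₁ - s))) := by
        have : 0 ≤ s * (B - C) * ((σ₁ - s) - x₂) := mul_nonneg (mul_nonneg hs0 (by linarith)) (by linarith)
        linarith only [this]
      linarith only [hΦ1, hΦ3, h1, h2, eR, c3 hlt]
    · -- B2: x₁* = σ₁ − x₂; R₂* ≥ ρ₄ by concavity on [a₂, s]
      have hX1 : x₁ ≤ σ₁ - x₂ := by linarith
      have ha2x : a₂ ≤ x₂ := by rcases ha2 with h | h <;> linarith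
      have hRs : ρ₄ ≤ (1 - σ₂) + (1 - E) * x₂ * (σ₂ - x₂) := concave_ge_const (by linarith) hρ4a hρ4b ha2x hx2s
      have hR0 : 0 ≤ (1 - x₂) * (1 - (σ₂ - x₂)) - E * x₂ * (σ₂ - x₂) := by rw [eR]; exact c4ρ.trans hRs
      have hΦ1 := push1 (σ₁ - x₂) (σ₂ - x₂) hX1 hX30 hR0
      refine ⟨?_, hR0.trans hR3⟩
      have h1σ : 0 ≤ 1 - (σ₁ - x₂) := by linarith
      have h1 : (1 - (σ₁ - x₂)) * ρ₄ ≤ (1 - (σ₁ - x₂)) * ((1 - σ₂) + (1 - E) * x₂ * (σ₂ - x₂)) := mul_le_mul_of_nonneg_left hRs h1σ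
      -- q(u) = (1−σ₁+u)ρ₄ − (σ₁−u)(Bu + C(σ₂−u)) = (B − C)u² + (ρ₄ + Cσ₂ − σ₁(B − C)·1 … ) : convex, tangent at a₂
      have htan := convex_quad_ge_tangent (α := B - C) (β := ρ₄ + C * σ₂ - σ₁ * (B - C)) (γ := (1 - σ₁) * ρ₄ - σ₁ * C * σ₂) (a := a₂) (u := x₂)
        (by linarith)
      have hline := affine_nonneg_between (t₀ := a₂) (t₁ := s) (t := x₂) c4a c4b ha2x hx2s
      linarith only [h1, htan, hline, hΦ1, hΦ3, eR]

end Summit.QuantumFields.BalabanUV.Beta.EriceRemainderEnclosureHistoryAutonomyComparisonAgeCompositionJointPolytope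

end
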